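import Literature.NumberTheory.GaloisCohomology.Howard2004.PiAdicRefinement
import Literature.NumberTheory.GaloisCohomology.Howard2004.PrincipalArtinianDivisibilityProofs
import Literature.NumberTheory.EllipticCurves.ZpExtensionEisensteinDVRSetting
import Literature.NumberTheory.EllipticCurves.ZpExtensionEisensteinTwistFreeProofs
import Literature.NumberTheory.EllipticCurves.IwasawaAlgebraEisensteinCoefficientRingProofs
import HarnessLib

/-!
# The `π`-adic refinement datum of an Eisenstein tower `k ↦ M_k ⊗ A_{m,k}(ψ)` over `S_𝔮 = Λ/(T^m + p)`
# (definitions with bodies + proved fields; no named fact, no instance, no `sorry`)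

Topic `NumberTheory/EllipticCurves` (D1 road of cell `pub/bsd-print-x9`; companion of `ZpExtensionEisensteinInvSystem`
(the two-index reductions `eisensteinTwistReduce hm (h : k ≤ k') (t h)` of a functorial system `t`),
`ZpExtensionEisensteinTowerExactProofs` (their kernels `p^k · T^{(k')}`), `ZpExtensionEisensteinTwistFreeProofs` (H.0:
the levels are free over `A_{m,k}`), `IwasawaAlgebraEisensteinCoefficientRingProofs` (`A_{m,k}` principal Artinian of
length `mk`) and `GaloisCohomology/Howard2004/PiAdicRefinement` (the abstract `PiRefinementDatum` and its two-index
family `T/π^aT → T/π^bT`)).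

B. Howard, Compositio Math. 140 (2004), proof of Thm. 2.2.10 («taking `𝔮 = T^m + p` … `S_𝔮` is a discrete
valuation ring», uniformiser `π = T`, `π^m = -p`), §1.6 (the tower `T/𝔪^k T`), Def. 1.1.3 (`Quot(T)`): for
Hypothesis H.3 at a level `T_𝔮/p^k T_𝔮 = M_k ⊗ A_{m,k}(ψ)` (`A_{m,k} = S_𝔮/π^{mk}`) one needs ALL the quotients
`T_𝔮/π^i` (`i ≤ mk`), i.e. the `π`-adic refinement of the `p`-adic tower.  This file packages the UNSHIFTED
Eisenstein tower `k ↦ EisensteinLevel p m M k` (`k ≥ 0`; `e_k = mk`) with its two-index `S_𝔮`-linear reductions as a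
`Howard2004.PiRefinementDatum K S_𝔮 (EisensteinLevel p m M)`:

* `ZpExtension.eisensteinRedLE κ ρ t hm (h : k ≤ k')` — the reduction `M_{k'} ⊗ A_{m,k'} → M_k ⊗ A_{m,k}` as an
  `S_𝔮`-LINEAR map (two-index form of `eisensteinLevelRed`);
* **`ZpExtension.eisensteinPiRefinementDatum κ ρ t ht₁ ht₂ hts hkt hm hfree`** — the datum: `π = T mod 𝔮`,
  `e k = m*k`, `host i = (i + m - 1)/m` (`= ⌈i/m⌉`, the least `p`-adic level carrying `T/π^i`), `ker_red` from
  `ker_eisensteinTwistReduceLinear` and `𝔪^{mk} = (p^k)`, `smul_mem_cancel` from H.0-freeness of the levels over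
  `A_{m,k}` and `EisensteinCoeff.isPrincipalArtinianOfLength` through the scalar tower `S_𝔮 → A_{m,k}`
  (`PrincipalArtinianDivisibilityProofs`);
* unfolding lemmas (`_ρ`, `_red_apply`, `_π`, `_e`, `_host`) and `host_mul : host (m*j) = j`, so that the
  sub-tower of `m`-th levels of the refinement sits over the `p`-adic levels `j` (x10b-p1-w7's
  `Tower.levelCondition_subtower_eq`).

Hypotheses on the module tower `M_k` (for `E`: `M_k = E[p^k]`, `t h = (P ↦ p^{k'-k} P)`): functoriality `ht₁/ht₂`,
surjectivity `hts`, kernels `hkt : t h x = 0 ↔ x = p^k • y`, freeness `hfree` of `M_k ⊗ A_{m,k}` over `A_{m,k}`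
(tree `Twisted.free_of_addEquiv`, `WeierstrassCurve.free_twisted_geomTorsion`).  Nothing about Selmer groups is
asserted; BSD is not proved by any of this.

References: [Howard2004HeegnerKolyvagin] §1.6 (arXiv p. 12 L29–55), Def. 1.1.3, Rem. 1.1.4, proof of Thm. 2.2.10;
[Washington1997] §13.2.
-/

set_option autoImplicit false

noncomputable section

open scoped TensorProduct ContRepresentation Pointwise
open Field IsLocalRing Function

namespace Literature.NumberTheory.EllipticCurves.ZpExtension

open Literature.NumberTheory.GaloisRepresentations
open Literature.NumberTheory.GaloisCohomology.Howard2004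

variable {K : Type} [Field K] {p : ℕ} [hp : Fact p.Prime] (κ : ZpExtension K p)
  {M : ℕ → Type} [∀ k, AddCommGroup (M k)] [∀ k, TopologicalSpace (M k)] [∀ k, DiscreteTopology (M k)]
  (ρ : ∀ k, DiscreteGaloisModule K (M k))
  (t : ∀ ⦃k k' : ℕ⦄, k ≤ k' → ((ρ k').toContRepresentation →ⁱL (ρ k).toContRepresentation))
  {m : ℕ} (hm : 1 ≤ m)

/-! ## §1 The two-index `S_𝔮`-linear reductions -/

/-- **The reduction `M_{k'} ⊗ A_{m,k'}(ψ) → M_k ⊗ A_{m,k}(ψ)` (`k ≤ k'`) as an `S_𝔮 = Λ/(q_m)`-linear map** between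
the level carriers (`κ.eisensteinTwistReduce hm h (t h)`; `S_𝔮`-linearity from `eisensteinTwistReduce_mk_smul`).
[cite: Howard2004HeegnerKolyvagin, §1.6 and §2.2 (arXiv p. 12: the tower T/𝔪^k T)] -/
def eisensteinRedLE {k k' : ℕ} (h : k ≤ k') :
    EisensteinLevel p m M k' →ₗ[IwasawaAlgebra p ⧸
        Ideal.span {(PowerSeries.X ^ m + PowerSeries.C (p : ℤ_[p]) : IwasawaAlgebra p)}]
      EisensteinLevel p m M k where
  toFun x := (κ.eisensteinTwistReduce hm h (t h)
    (x : IwasawaAlgebra.EisensteinCoeff.Twisted p m k' (M k')) :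
      IwasawaAlgebra.EisensteinCoeff.Twisted p m k (M k))
  map_add' x y := map_add _ _ _
  map_smul' c x := by
    obtain ⟨f, rfl⟩ := Ideal.Quotient.mk_surjective c
    rw [RingHom.id_apply, EisensteinLevel.quotient_mk_smul_def, EisensteinLevel.quotient_mk_smul_def]
    exact κ.eisensteinTwistReduce_mk_smul hm h (t h) f _

/-- Unfolding `eisensteinRedLE`: it is `eisensteinTwistReduce hm h (t h)`. [cite: Howard2004HeegnerKolyvagin, §2.2] -/
@[simp]
theorem eisensteinRedLE_apply {k k' : ℕ} (h : k ≤ k') (x : EisensteinLevel p m M k') :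
    κ.eisensteinRedLE ρ t hm h x =
      κ.eisensteinTwistReduce hm h (t h) (x : IwasawaAlgebra.EisensteinCoeff.Twisted p m k' (M k')) :=
  rfl

/-! ## §2 Arithmetic of the host function `⌈i/m⌉` -/

include hm in
/-- `i ≤ m ⌈i/m⌉`. [cite: Howard2004HeegnerKolyvagin, proof of Thm. 2.2.10 (𝔮 = T^m + p: e_k = mk)] -/
theorem le_mul_ceilDiv (i : ℕ) : i ≤ m * ((i + m - 1) / m) := by
  have h1 := Nat.div_add_mod (i + m - 1) m
  have h2 := Nat.mod_lt (i + m - 1) hm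
  omega

include hm in
/-- `⌈(m j)/m⌉ = j`. [cite: Howard2004HeegnerKolyvagin, proof of Thm. 2.2.10 (e_k = mk)] -/
theorem ceilDiv_mul (j : ℕ) : (m * j + m - 1) / m = j := by
  have h1 : m * j + m - 1 = (m - 1) + m * j := by omega
  rw [h1, Nat.add_mul_div_left _ _ hm, Nat.div_eq_of_lt (by omega), zero_add]

/-! ## §3 The datum -/

/-- **`ker (M_{k'} ⊗ A_{m,k'} ↠ M_k ⊗ A_{m,k}) = π^{mk} · (M_{k'} ⊗ A_{m,k'})`** as an `S_𝔮`-submodule (from the tree's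
`eisensteinTwistReduceLinear_eq_zero_iff`: the kernel is `p^k ·`, and `(π^{mk}) = (p^k)` in `S_𝔮`).
[cite: Howard2004HeegnerKolyvagin, §1.6 (arXiv p. 12: the exact tower) and proof of Thm. 2.2.10] -/
theorem ker_eisensteinRedLE (hts : ∀ ⦃k k' : ℕ⦄ (h : k ≤ k'), Surjective (t h))
    (hkt : ∀ ⦃k k' : ℕ⦄ (h : k ≤ k') (x : M k'), t h x = 0 ↔ ∃ y : M k', x = ((p : ℤ) ^ k) • y)
    {k k' : ℕ} (h : k ≤ k') :
    LinearMap.ker (κ.eisensteinRedLE ρ t hm h) =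
      Ideal.span {(Ideal.Quotient.mk _ PowerSeries.X : IwasawaAlgebra p ⧸
          Ideal.span {(PowerSeries.X ^ m + PowerSeries.C (p : ℤ_[p]) : IwasawaAlgebra p)}) ^ (m * k)} •
        (⊤ : Submodule (IwasawaAlgebra p ⧸
          Ideal.span {(PowerSeries.X ^ m + PowerSeries.C (p : ℤ_[p]) : IwasawaAlgebra p)}) (EisensteinLevel p m M k')) := by
  have hspan : Ideal.span {(Ideal.Quotient.mk _ PowerSeries.X : IwasawaAlgebra p ⧸
      Ideal.span {(PowerSeries.X ^ m + PowerSeries.C (p : ℤ_[p]) : IwasawaAlgebra p)}) ^ (m * k)} =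
      Ideal.span {((p : IwasawaAlgebra p ⧸
        Ideal.span {(PowerSeries.X ^ m + PowerSeries.C (p : ℤ_[p]) : IwasawaAlgebra p)})) ^ k} := by
    rw [← Ideal.span_singleton_pow, ← IwasawaAlgebra.maximalIdeal_quotient_X_pow_add_C_eq p hm,
      IwasawaAlgebra.maximalIdeal_pow_mul_eq_span_natCast_pow p hm k]
  ext x
  rw [LinearMap.mem_ker, hspan, Submodule.ideal_span_singleton_smul, Submodule.mem_smul_pointwise_iff_exists]
  have hiff := eisensteinTwistReduceLinear_eq_zero_iff (p := p) (m := m) h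
    (t h).toContinuousLinearMap.toLinearMap (hts h) (hkt h)
    (x : IwasawaAlgebra.EisensteinCoeff.Twisted p m k' (M k'))
  have hcast : ∀ y : EisensteinLevel p m M k',
      ((p : IwasawaAlgebra p ⧸ Ideal.span {(PowerSeries.X ^ m + PowerSeries.C (p : ℤ_[p]) : IwasawaAlgebra p)}) ^ k) •
        y = ((p : ℤ) ^ k) • y := fun y => by
    rw [← Nat.cast_pow, Nat.cast_smul_eq_nsmul, ← Nat.cast_pow, natCast_zsmul]
  constructor
  · intro hx
    obtain ⟨y, hy⟩ := hiff.mp hx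
    exact ⟨y, Submodule.mem_top, (hcast y).trans hy.symm⟩
  · rintro ⟨y, -, rfl⟩
    exact hiff.mpr ⟨y, (hcast y)⟩

omit [∀ k, TopologicalSpace (M k)] [∀ k, DiscreteTopology (M k)] in
/-- **Exact `π`-divisibility below `mk` on the level `M_k ⊗ A_{m,k}`** (free over the principal Artinian ring
`A_{m,k}` of length `mk`, `S_𝔮` acting through `A_{m,k}`): `c + n ≤ mk`, `π^n x ∈ π^{c+n} · T^{(k)}` ⇒
`x ∈ π^c · T^{(k)}`. [cite: Howard2004HeegnerKolyvagin, Rem. 1.1.4, H.0 and §1.6 (arXiv p. 5 L100–105, p. 7 L57, p. 12)] -/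
theorem smul_mem_cancel_eisensteinLevel (hm : 1 ≤ m)
    (hfree : ∀ k, Module.Free (IwasawaAlgebra.EisensteinCoeff p m k) (EisensteinLevel p m M k)) (k : ℕ) (x : EisensteinLevel p m M k) (c n : ℕ) (hcn : c + n ≤ m * k)
    (hx : (Ideal.Quotient.mk _ PowerSeries.X : IwasawaAlgebra p ⧸
        Ideal.span {(PowerSeries.X ^ m + PowerSeries.C (p : ℤ_[p]) : IwasawaAlgebra p)}) ^ n • x ∈
      Ideal.span {(Ideal.Quotient.mk _ PowerSeries.X : IwasawaAlgebra p ⧸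
          Ideal.span {(PowerSeries.X ^ m + PowerSeries.C (p : ℤ_[p]) : IwasawaAlgebra p)}) ^ (c + n)} •
        (⊤ : Submodule (IwasawaAlgebra p ⧸
          Ideal.span {(PowerSeries.X ^ m + PowerSeries.C (p : ℤ_[p]) : IwasawaAlgebra p)}) (EisensteinLevel p m M k))) :
    x ∈ Ideal.span {(Ideal.Quotient.mk _ PowerSeries.X : IwasawaAlgebra p ⧸
          Ideal.span {(PowerSeries.X ^ m + PowerSeries.C (p : ℤ_[p]) : IwasawaAlgebra p)}) ^ c} •
        (⊤ : Submodule (IwasawaAlgebra p ⧸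
          Ideal.span {(PowerSeries.X ^ m + PowerSeries.C (p : ℤ_[p]) : IwasawaAlgebra p)}) (EisensteinLevel p m M k)) := by
  rcases Nat.eq_zero_or_pos k with rfl | hk
  · -- `A_{m,0} = 0`, so the level is trivial
    have hx0 : x = 0 := by
      have := IwasawaAlgebra.EisensteinCoeff.natCast_pow_smul_eq_zero (p := p) m 0 x
      rwa [pow_zero, one_smul] at this
    rw [hx0]
    exact Submodule.zero_mem _
  · letI := IwasawaAlgebra.EisensteinCoeff.algebraOfSpec p m k
    haveI := EisensteinLevel.isScalarTower_algebraOfSpec p m M k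
    haveI := IwasawaAlgebra.EisensteinCoeff.isLocalRing_eisensteinCoeff p hm hk
    haveI := hfree k
    have hmax := IwasawaAlgebra.EisensteinCoeff.maximalIdeal_eisensteinCoeff_eq p hm hk
    have hP := IwasawaAlgebra.EisensteinCoeff.isPrincipalArtinianOfLength (p := p) hm hk
    have halg : algebraMap (IwasawaAlgebra p ⧸
        Ideal.span {(PowerSeries.X ^ m + PowerSeries.C (p : ℤ_[p]) : IwasawaAlgebra p)})
        (IwasawaAlgebra.EisensteinCoeff p m k) (Ideal.Quotient.mk _ PowerSeries.X) =
        (Ideal.Quotient.mk _ PowerSeries.X : IwasawaAlgebra.EisensteinCoeff p m k) :=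
      IwasawaAlgebra.EisensteinCoeff.ofSpec_mk p m k PowerSeries.X
    rw [← halg] at hmax
    exact mem_span_pow_smul_top_of_pow_smul_mem_of_isScalarTower
      (A := IwasawaAlgebra.EisensteinCoeff p m k) hmax hP hcn hx

variable (ht₁ : ∀ (k : ℕ) (x : M k), t (le_refl k) x = x)
  (ht₂ : ∀ ⦃a b c : ℕ⦄ (h₁ : a ≤ b) (h₂ : b ≤ c) (x : M c), t (h₁.trans h₂) x = t h₁ (t h₂ x))
  (hts : ∀ ⦃k k' : ℕ⦄ (h : k ≤ k'), Surjective (t h))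
  (hkt : ∀ ⦃k k' : ℕ⦄ (h : k ≤ k') (x : M k'), t h x = 0 ↔ ∃ y : M k', x = ((p : ℤ) ^ k) • y)
  (hfree : ∀ k, Module.Free (IwasawaAlgebra.EisensteinCoeff p m k) (EisensteinLevel p m M k))

/-- **The `π`-adic refinement datum of the Eisenstein tower** `k ↦ M_k ⊗ A_{m,k}(ψ)` over `S_𝔮`: two-index
reductions `eisensteinRedLE`, `π = T mod 𝔮`, `e_k = mk`, host `⌈i/m⌉`; all fields proved.
[cite: Howard2004HeegnerKolyvagin, §1.6 (arXiv p. 12 L29–55), Def. 1.1.3 and proof of Thm. 2.2.10 (𝔮 = T^m + p)] -/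
def eisensteinPiRefinementDatum :
    PiRefinementDatum K (IwasawaAlgebra p ⧸
        Ideal.span {(PowerSeries.X ^ m + PowerSeries.C (p : ℤ_[p]) : IwasawaAlgebra p)}) (EisensteinLevel p m M) where
  ρ k := (κ.eisensteinTwist (ρ k) hm k : ContinuousRep (absoluteGaloisGroup K) ℤ (EisensteinLevel p m M k))
  hlin k σ c x := by
    obtain ⟨f, rfl⟩ := Ideal.Quotient.mk_surjective c
    rw [EisensteinLevel.quotient_mk_smul_def, EisensteinLevel.quotient_mk_smul_def]
    exact κ.eisensteinTwist_apply_smul (ρ k) hm k σ _ _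
  red _ _ h := κ.eisensteinRedLE ρ t hm h
  red_equivariant _ _ h σ x := congrArg (fun φ ↦ φ x) ((κ.eisensteinTwistReduce hm h (t h)).isIntertwining' σ)
  red_refl k x := by
    change κ.eisensteinTwistReduce hm (le_refl k) (t (le_refl k)) x = x
    induction x using IwasawaAlgebra.EisensteinCoeff.Twisted.induction_on with
    | zero => exact map_zero _
    | tmul c a =>
      rw [eisensteinTwistReduce_tmul, IwasawaAlgebra.EisensteinCoeff.reduce_refl]
      exact congrArg (IwasawaAlgebra.EisensteinCoeff.Twisted.tmul c) (ht₁ k a)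
    | add x y hx hy => rw [map_add, hx, hy]
  red_trans _ _ _ h₁ h₂ x := by
    change κ.eisensteinTwistReduce hm (h₁.trans h₂) (t (h₁.trans h₂)) x =
      κ.eisensteinTwistReduce hm h₁ (t h₁) (κ.eisensteinTwistReduce hm h₂ (t h₂) x)
    induction x using IwasawaAlgebra.EisensteinCoeff.Twisted.induction_on with
    | zero => simp only [map_zero]
    | tmul c a =>
      rw [eisensteinTwistReduce_tmul, eisensteinTwistReduce_tmul, eisensteinTwistReduce_tmul,
        IwasawaAlgebra.EisensteinCoeff.reduce_reduce]
      exact congrArg (IwasawaAlgebra.EisensteinCoeff.Twisted.tmul _) (ht₂ h₁ h₂ a)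
    | add x y hx hy => rw [map_add, map_add, hx, hy, map_add]
  red_surjective _ _ h := κ.eisensteinTwistReduce_surjective hm h (t h) (hts h)
  π := Ideal.Quotient.mk _ PowerSeries.X
  e k := m * k
  e_mono a b hab := Nat.mul_le_mul_left m hab
  ker_red _ _ h := κ.ker_eisensteinRedLE ρ t hm hts hkt h
  smul_mem_cancel k x c n hcn hx := smul_mem_cancel_eisensteinLevel hm hfree k x c n hcn hx
  host i := (i + m - 1) / m
  host_mono a b hab := Nat.div_le_div_right (by omega)
  le_e_host i := le_mul_ceilDiv hm i

/-! ## §4 Unfolding -/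

/-- The levels of the datum are the twisted modules. [cite: Howard2004HeegnerKolyvagin, §2.2] -/
theorem eisensteinPiRefinementDatum_ρ (k : ℕ) :
    (κ.eisensteinPiRefinementDatum ρ t hm ht₁ ht₂ hts hkt hfree).ρ k =
      (κ.eisensteinTwist (ρ k) hm k : ContinuousRep (absoluteGaloisGroup K) ℤ (EisensteinLevel p m M k)) :=
  rfl

/-- The reductions of the datum are `eisensteinTwistReduce hm h (t h)`. [cite: Howard2004HeegnerKolyvagin, §2.2] -/
theorem eisensteinPiRefinementDatum_red_apply {k k' : ℕ} (h : k ≤ k') (x : EisensteinLevel p m M k') :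
    (κ.eisensteinPiRefinementDatum ρ t hm ht₁ ht₂ hts hkt hfree).red h x =
      κ.eisensteinTwistReduce hm h (t h) (x : IwasawaAlgebra.EisensteinCoeff.Twisted p m k' (M k')) :=
  rfl

/-- `π = T mod 𝔮`. [cite: Howard2004HeegnerKolyvagin, proof of Thm. 2.2.10] -/
theorem eisensteinPiRefinementDatum_π :
    (κ.eisensteinPiRefinementDatum ρ t hm ht₁ ht₂ hts hkt hfree).π = Ideal.Quotient.mk _ PowerSeries.X :=
  rfl

/-- `e_k = mk`. [cite: Howard2004HeegnerKolyvagin, proof of Thm. 2.2.10] -/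
theorem eisensteinPiRefinementDatum_e (k : ℕ) :
    (κ.eisensteinPiRefinementDatum ρ t hm ht₁ ht₂ hts hkt hfree).e k = m * k :=
  rfl

/-- `host i = ⌈i/m⌉`. [cite: Howard2004HeegnerKolyvagin, proof of Thm. 2.2.10] -/
theorem eisensteinPiRefinementDatum_host (i : ℕ) :
    (κ.eisensteinPiRefinementDatum ρ t hm ht₁ ht₂ hts hkt hfree).host i = (i + m - 1) / m :=
  rfl

/-- **`host (m j) = j`**: the `m`-th levels of the refinement are hosted on the `p`-adic levels (so the sub-tower
`j ↦ Level (m j)` of x10b-p1-w7's `Tower.levelCondition_subtower_eq` sits over `T_𝔮/p^j`).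
[cite: Howard2004HeegnerKolyvagin, §1.6 (arXiv p. 12 L29–55: cofinal systems T/𝔪^k)] -/
theorem eisensteinPiRefinementDatum_host_mul (j : ℕ) :
    (κ.eisensteinPiRefinementDatum ρ t hm ht₁ ht₂ hts hkt hfree).host (m * j) = j :=
  ceilDiv_mul hm j

/-- `host (m j) ≤ j` (the form consumed by `PiRefinementDatum.proj`). [cite: Howard2004HeegnerKolyvagin, §1.6 (arXiv p. 12 L29–55)] -/
theorem eisensteinPiRefinementDatum_host_mul_le (j : ℕ) :
    (κ.eisensteinPiRefinementDatum ρ t hm ht₁ ht₂ hts hkt hfree).host (m * j) ≤ j :=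
  (κ.eisensteinPiRefinementDatum_host_mul ρ t hm ht₁ ht₂ hts hkt hfree j).le

end Literature.NumberTheory.EllipticCurves.ZpExtension

end
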